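import Literature.Computability.Cryptography.ShiftSamplingFamily
import Literature.Computability.Cryptography.CEstFP
import HarnessLib

/-!
# Fourier sampling of a computed table, V: the characters read off the measured string, in polynomial time

Topic `Computability/Cryptography`; joins `ShiftSamplingFamily.lean` (the structured read-out
`readOf n v` of a measured string `v` of the quantum core, unit by unit) to `CEstFP.lean` (Kitaev's
character estimate of one unit presented as a bit list, `γL`, and its polynomial-time computation
`codeFP_cEstL`). Theorem-and-definition file, no named facts.

* `readOf_apply_eq_γL` — the read-out of unit `u` is the bit-list read-out `γL Lv B` of the string
  dropped to position `n + K u` (the layout `eCtl`: control `(u, l, σ, i)` at `n + K u + i + Bσ + 2Bl`);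
* `charOf P n v u = cEst 2^L (readOf n v u)` (`charOf_eq`) and **`codeFP_charOf`**: `((1ⁿ, v), u) ↦`
  the character of unit `u`, computed on codes in polynomial time from the sizes of `P`.

## References

* A. Yu. Kitaev, arXiv:quant-ph/9511026 (1995), §3 (Thm 1). [Kitaev1995]
* R. Jozsa, arXiv:quant-ph/0302134 (2003), §10. [Jozsa2003]
-/

noncomputable section

namespace Literature.Computability.Cryptography

namespace ShiftSampling

open _root_.Computability Complexity Complexity.CodeFP Kitaev1995 PeriodFinding Finset

namespace SSParams

variable (P : SSParams) (n : ℕ)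

/-- The value of `eK.symm (l, σ, i)`: `i + B σ + 2B l` (as `val_eK_symm` of `ShiftSamplingUniform.lean`, reproved to keep the imports light). [folklore] -/
private theorem val_eK_symm' (l : Fin (P.Lv n)) (σ : Bool) (i : Fin (P.B n)) :
    ((P.eK n).symm (l, σ, i) : ℕ) = (i : ℕ) + P.B n * σ.toNat + 2 * P.B n * l := by
  cases σ <;> rfl

/-- **The read-out of unit `u` is the bit-list read-out of the string dropped to `n + K u`.** [folklore] -/
theorem readOf_apply_eq_γL (v : List Bool) (u : Fin (P.nU n)) :
    P.readOf n v u = γL (P.Lv n) (P.B n) (v.drop (n + P.K n * u)) := by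
  funext τ
  obtain ⟨l, σ, i⟩ := τ
  simp only [readOf, structRead, ctlOf, γL, posOf]
  rw [List.getD_eq_getElem?_getD, List.getD_eq_getElem?_getD, List.getElem?_drop, val_eCtl_symm, val_eK_symm']
  congr 2
  ring

/-- **The character of unit `u`** read off the measured string `v` on inputs of length `n`.
[cite: Kitaev1995, §3 Thm 1] -/
def charOf (v : List Bool) (u : ℕ) : ℕ := cEstL (2 ^ P.L n) (P.Lv n) (P.B n) (v.drop (n + P.K n * u))

/-- `charOf` is Kitaev's estimate of the unit's character. [folklore] -/
theorem charOf_eq (v : List Bool) (u : Fin (P.nU n)) : P.charOf n v u = cEst (2 ^ P.L n) (P.readOf n v u) := by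
  rw [charOf, cEstL, readOf_apply_eq_γL]

variable {n}

section FP

variable (hnU : CodeFP unE unE P.nU) (hL : CodeFP unE unE P.L) (hLv : CodeFP unE unE P.Lv) (hB : CodeFP unE unE P.B)
include hL hLv hB

/-- **The characters are read off in polynomial time**: `((1ⁿ, v), u) ↦ charOf n v u`. [cite: Kitaev1995, §3 Thm 1] -/
theorem codeFP_charOf : CodeFP (pairE (pairE unE strE) natE) natE (fun c => P.charOf c.1.1 c.1.2 c.2) := by
  have hn : CodeFP (pairE (pairE unE strE) natE) unE (fun c => c.1.1) := (fst _ _).fst'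
  have hv : CodeFP (pairE (pairE unE strE) natE) strE (fun c => c.1.2) := (fst _ _).snd'
  have hu : CodeFP (pairE (pairE unE strE) natE) natE (fun c => c.2) := snd _ _
  have hK : CodeFP (pairE (pairE unE strE) natE) natE (fun c => P.K c.1.1) := natOfUn.comp ((K_un hLv hB).comp hn)
  have hamtN : CodeFP (pairE (pairE unE strE) natE) natE (fun c => c.1.1 + P.K c.1.1 * c.2) :=
    (natAdd.comp ((natOfUn.comp hn).pair (natMul.comp (hK.pair hu))) :)
  -- the drop amount in unary, capped by the string length (dropping past the end is dropping all)
  have hamt : CodeFP (pairE (pairE unE strE) natE) unE (fun c => min (c.1.1 + P.K c.1.1 * c.2) c.1.2.length) :=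
    (unOfNatMin.comp ((strLength.comp hv).pair hamtN) :)
  have hdrop0 : CodeFP (pairE (pairE unE strE) natE) strE (fun c => c.1.2.drop (min (c.1.1 + P.K c.1.1 * c.2) c.1.2.length)) :=
    (strDrop.comp (hamt.pair hv) :)
  have hdrop : CodeFP (pairE (pairE unE strE) natE) strE (fun c => c.1.2.drop (c.1.1 + P.K c.1.1 * c.2)) :=
    hdrop0.congr fun c => by
      by_cases h : c.1.1 + P.K c.1.1 * c.2 ≤ c.1.2.length
      · rw [min_eq_left h]
      · push Not at h
        rw [min_eq_right h.le, List.drop_length, List.drop_eq_nil_of_le h.le]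
  have hQ : CodeFP (pairE (pairE unE strE) natE) natE (fun c => 2 ^ P.L c.1.1) := (natPow.comp ((const _ 2).pair (hL.comp hn)) :)
  have hctx : CodeFP (pairE (pairE unE strE) natE) CE (fun c => (2 ^ P.L c.1.1, (P.Lv c.1.1, (P.B c.1.1, c.1.2.drop (c.1.1 + P.K c.1.1 * c.2))))) :=
    (hQ.pair ((hLv.comp hn).pair ((hB.comp hn).pair hdrop)) :)
  have hfin := (codeFP_cEstL.comp hctx :)
  exact hfin.congr fun c => rfl

end FP

end SSParams

end ShiftSampling

end Literature.Computability.Cryptography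

end
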